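import Summits.Schanuel.Schanuel.Theorems.RootDecomp1KNW96Core08
import Summits.Schanuel.Schanuel.Theorems.RootDecomp1KHyper06

/-!
# RootDecomp1KNW96Core — lens 6, generation 23 «RAT-EXP SLOT BY PROOF» (RULE G24 (iii); CLAIM L2180/L2181, CHECKLIST G24-α = ACK L2182, NODE L2192 / REQUEST L2193, writer re-check L2196, critic VERDICT L2194: CLEARED — THEOREM ×1 (G24-α) «(α)-literal: `theorem explicitRatExpApprox_holds : RootDecomp1KHyper.HyperCell.ExplicitRatExpApprox` — the tree slot AS TYPED (Hyper06 l.75, constant `C₀rat`), HYPOTHESIS-FREE, axioms standard»; RULE G25; lens-6 tally THEOREM ×7 + CELL ×3 + AUDIT ×1) — continuation (RootDecomp1KNW96Core09): §8 Slot — κNW 400 ≤ C₀rat pointwise and `explicitRatExpApprox_holds`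

(lens-6 g23 HOME kernel K‴ = HOME/decomp-schanuel-lens-6/g23/g24/NW96RatExpSlot.lean 65615678…, 2391 l = K′ NW96Main.lean (graded L2175; tree parts 01–07) + §7 RatExp (l.2023–2337) + §8 Slot (l.2339–2387); K″ NW96RatExp.lean 2ce876f1… = K‴ minus the Hyper06 import and §8. Port by census-1 gen 19 as `RootDecomp1KNW96Core08` = §7 (imports Core07 + Literature QuadraticRelationsLogarithmsMahlerWeil + PiAlgebraicApproximationMeasure): the c-generic slot `ExplicitRatExpApproxC κ`, `.mono`, the DISPLAYED constant function `κNW c r = c · 4.63 · (7 + 2|r|) · (13 + 2 log max(1,|r|) + log max(|num r|, den r))`, the exponent lemmas F1/F2/F3, `κNW_margin`, the DERIVATION `ratExpC_of_mainR (hc : 1 ≤ c) (hNW : NW1996MainR c) : ExplicitRatExpApproxC (κNW c)` (θ = β = r, α = ξ; D = n by `NesterenkoWaldschmidt1996.finrank_adjoin_eq_natDegree`, heights by `RoyWaldschmidt1997.MahlerWeil.weilHeight₁_root_le`, BY NAME) and `explicitRatExpApproxC_400`; `RootDecomp1KNW96Core09` = §8 (imports Core08 + RootDecomp1KHyper06):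 `explicitRatExpApproxC_C₀rat_iff` (Iff.rfl), `κNW_400_le_C₀rat`, and the headline `explicitRatExpApprox_holds : ExplicitRatExpApprox` HYPOTHESIS-FREE.
PORT EDITS: the slot def's docstring tagged «[slot] definition with parameter; suppliers …» (census convention, verdict condition); statements and proofs verbatim; no `set_option` in §7/§8. `--supports stmt-Schanuel-33364`; no census credit carried; rung 0 — nothing here proves Schanuel. CONSEQUENCE OF RECORD (RULE G25 (i)): every `(hX : ExplicitRatExpApprox)` binder in the tree is dischargeable BY NAME `explicitRatExpApprox_holds` — census relabel bookkeeping ×0.)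
-/

noncomputable section

open Finset

namespace Summit.Schanuel.Schanuel.Theorems.RootDecomp1KNW96Core

open Literature.NumberTheory.Transcendental

/-! ## §8. The tree slot AS TYPED (RULE G24 (iii)): `κNW 400 ≤ C₀rat` pointwise, hence
`RootDecomp1KHyper.HyperCell.ExplicitRatExpApprox` — carried as the hypothesis `hX` by five lineages' records and so
far obtained only from the fact `NesterenkoWaldschmidt1996_thm_5_1` (`RootDecomp1KHyper19.explicitRatExpApprox_of_NW1996`)
— HOLDS, hypothesis-free. -/

section Slot

open Summit.Schanuel.Schanuel.Theorems.RootDecomp1KHyper.HyperCell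

/-- Read-back: the tree slot is `ExplicitRatExpApproxC C₀rat`, DEFINITIONALLY. -/
theorem explicitRatExpApproxC_C₀rat_iff : ExplicitRatExpApproxC C₀rat ↔ ExplicitRatExpApprox := Iff.rfl

/-- `κNW 400 r ≤ C₀rat r` for every `r`: with `G = ⌈|r|⌉₊`, `H = log max(|num r|, den r)`,
`κNW 400 r = 1852·(7+2|r|)·(13 + 2 log max(1,|r|) + H) ≤ 12964·(G+2)·(23+G+H)` while
`C₀rat r = 1.28·10⁹·(G+2)·(23+G+H)²` (three orders of magnitude of room). -/
theorem κNW_400_le_C₀rat (r : ℚ) : κNW 400 r ≤ C₀rat r := by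
  unfold κNW C₀rat
  set a : ℝ := |(r : ℝ)| with ha
  set H : ℝ := Real.log (max (|(r.num : ℝ)|) (r.den : ℝ)) with hH
  set G : ℝ := ((⌈|(r : ℝ)|⌉₊ : ℕ) : ℝ) with hG
  have ha0 : 0 ≤ a := abs_nonneg _
  have hG0 : 0 ≤ G := Nat.cast_nonneg _
  have haG : a ≤ G := by rw [ha, hG]; exact Nat.le_ceil _
  have hden1 : (1 : ℝ) ≤ r.den := by exact_mod_cast r.pos
  have hH0 : 0 ≤ H := Real.log_nonneg (le_max_of_le_right hden1)
  have hm0 : 0 < max 1 a := lt_of_lt_of_le one_pos (le_max_left _ _)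
  have hlogm : Real.log (max 1 a) ≤ G := by
    have h1 := Real.log_le_sub_one_of_pos hm0
    have h2 : max 1 a ≤ G + 1 := max_le (by linarith) (by linarith)
    linarith
  have hlogm0 : 0 ≤ Real.log (max 1 a) := Real.log_nonneg (le_max_left _ _)
  have k1 : 7 + 2 * a ≤ 7 / 2 * (G + 2) := by linarith
  have k2 : 13 + 2 * Real.log (max 1 a) + H ≤ 2 * (23 + G + H) := by linarith
  have k3 : (400 : ℝ) * (463 / 100) * (7 + 2 * a) * (13 + 2 * Real.log (max 1 a) + H) ≤
      400 * (463 / 100) * (7 / 2 * (G + 2)) * (2 * (23 + G + H)) :=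
    mul_le_mul (mul_le_mul_of_nonneg_left k1 (by norm_num)) k2 (by positivity) (by positivity)
  have k4 : 23 * (23 + G + H) ≤ (1 + (20 + (G + 2) + H)) ^ 2 := by nlinarith
  have k5 : 400 * (463 / 100) * (7 / 2 * (G + 2)) * (2 * (23 + G + H)) ≤
      1280000000 * (G + 2) * (1 + (20 + (G + 2) + H)) ^ 2 := by nlinarith
  exact k3.trans k5

/-- **THE SLOT, HYPOTHESIS-FREE.** `ExplicitRatExpApprox` (Hyper06: for `r ∈ ℚ∖{0}`, `ξ` a root of an irreducible
`Q ∈ ℤ[X]` of degree `n ≥ 1`, `log M(Q) ≤ Y`, `Y ≥ log 16`: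
`‖e^r − ξ‖ ≥ exp(−C₀rat(r)·n²·Y·(log Y + log n)²/(log Y)²)`) — PROVED: Theorem 1 with `c = 400`
(`nw1996MainR_400`) ⟹ the slot with `κNW 400` (§7) ⟹ the slot with the larger `C₀rat` (monotonicity). -/
theorem explicitRatExpApprox_holds : ExplicitRatExpApprox :=
  explicitRatExpApproxC_C₀rat_iff.mp (explicitRatExpApproxC_400.mono κNW_400_le_C₀rat)

end Slot

end Summit.Schanuel.Schanuel.Theorems.RootDecomp1KNW96Core

end
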